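import Mathlib
import HarnessLib

/-!
# Thin-sector four-leg counting: the COOPER-RANGE TOLERANCE (thin boxes near `k₂ + k₃ ≈ 0` pin the level of the fourth leg to `O(w² + w·|c − π|)`)

Topic `Literature/MathematicalPhysics/QuantumLattice`; namespace `ThinSectorCount` (continues `ThinSectorCornerCluster`).  Fourth file of the
log-free ANISOTROPIC anchored four-sector counting lemma («E1-P2-THIN-COUNT», cell gate-hubbard-kl, plan g17 (R41); owner seat p4; plan
HOME/prover-p4/E1-P2-THIN-COUNT-PLAN.md §File 4 design).  The Cooper range of the four-leg count is where the two summed legs are nearly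
antipodal, `θ₃ = θ₂ + c`, `|c − π| ≤ τ`.  For ISOTROPIC sectors (boxes `w × w`) the level of the fourth leg is only known to `O(w)` and the count
along the Cooper range carries the printed logarithm (Mastropietro, *Non-Perturbative Renormalization*, p. 229, «`γ^{−h}|h|`»).  For THIN
(anisotropic) sectors — tangential width `w`, normal thickness `≲ w²` — the observation behind the anisotropic Sector Lemma (Mastropietro (14.67)
p. 223; Benfatto–Giuliani–Mastropietro 2006 (2.89)/Lemma A3.1; Rivasseau 2002 Lemma 5; Disertori–Rivasseau II p. 2: «when `k₁ + k₂` is small the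
fourth sector is fixed up to `|k₁ + k₂|`») is that the level function of the fourth leg has a SMALL GRADIENT at every near-solution of the Cooper
range: its three angular partials are `O(|c − π| + w²/|c − π|)` there, so moving the three legs across their boxes changes the level only by
`O(w·|c − π| + w²)`.

This file proves exactly that, for an ABSTRACT centrally symmetric `C¹` curve `γ` (`γ(θ + π) = −γ(θ)`, `‖γ′‖ ≤ V`, `γ′` `A`-Lipschitz) lying on the
level set `{E = μ}` of an abstract differentiable `E` on a real normed space (`‖E′‖ ≤ G`, `E′` `H`-Lipschitz, `0 ≤ H`) — the Hubbard instances are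
the band curve (`E = ε₂`) and the frame / scale-`h` curves (`E = ε₂ + δ`) of the programme; `h(θ₁, θ₂, θ₃) := E(γθ₁ + γθ₂ + γθ₃) − μ`:

* §1 calculus: segment mean-value inequalities, the pairing estimate `|E′(S)v − E′(S₀)v₀| ≤ H·D₁·V + G·D₂`, `γ′(θ + π) = −γ′(θ)`
  (`curve_deriv_add_pi`), `E′(γθ)[γ′θ] = 0` (`fderiv_apply_tangent_eq_zero`), the partials of `h` (`hasDerivAt_level3_one/two/three`) and
  `h(θ₁, x, x + π) = 0` (`level3_antipodal`);
* §2 **`abs_cooperCoeff_le`** — at a near-solution `|h(θ₁′, x′, y′)| ≤ ρ` with `d := |y′ − x′ − π| > 0`, the Cooper coefficient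
  `g := E′(γθ₁′)[γ′(x′ + π)]` obeys `|g| ≤ ρ/d + (H·V² + G·A)·d`;
* §3 **`abs_level3_le_of_near_zero`** — for centres `(θ₁, x, x + c)` within `ω` of `(θ₁′, x′, y′)`:
  `|h(θ₁, x, x + c)| ≤ ρ + ω·(2ρ/d + (5HV² + 3GA)·d + (8HV² + 2GA)·ω)`;
  **`abs_level3_le_thin`** — in sector currency (`ω ≤ w`, `ρ ≤ C_r·w²`, `d₀·w ≤ d`):
  `|h(θ₁, x, x + c)| ≤ (C_r + 2C_r/d₀ + 2K₁ + K₂)·w² + K₁·w·|c − π|`, `K₁ = 5HV² + 3GA`, `K₂ = 8HV² + 2GA` — the shift-affine tolerance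
  `δ₀ + δ₁·|c − π|`, `δ₀ ≍ w²`, `δ₁ ≍ w`, consumed by `BandSectorCounting.count_odd_total_affine/_thin` (`ThinSectorCooperRange`).

Pure real analysis; everything is proved; no definitions, no named facts.  Nothing asserts superconductivity.

## Sources

* V. Mastropietro, *Non-Perturbative Renormalization* (World Scientific, 2008), ch. 14, Sector Lemma (14.67), p. 223; p. 229. [Mastropietro2008]
* G. Benfatto, A. Giuliani, V. Mastropietro, Ann. Henri Poincaré 7 (2006) 809–898, (2.89), App. A3 Lemma A3.1. [BenfattoGiulianiMastropietro2006]
* V. Rivasseau, J. Stat. Phys. 106 (2002) 693–722 (arXiv:cond-mat/0107118), Lemma 5 p. 9 (anisotropic sector counting).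
-/

noncomputable section

namespace Literature.MathematicalPhysics.QuantumLattice.ThinSectorCount

open Real Set

/-! ## §1 Calculus of the three-leg level function on a centrally symmetric level curve -/

section Calculus

variable {F : Type*} [NormedAddCommGroup F] [NormedSpace ℝ F]

/-- Segment mean-value inequality: `‖f b − f a‖ ≤ C·|b − a|` when `‖f′‖ ≤ C` on `[a, b]`. [folklore] -/
private theorem norm_sub_le_mul_of_hasDerivAt {f f' : ℝ → F} {C a b : ℝ} (hf : ∀ t, HasDerivAt f (f' t) t)
    (hC : ∀ t ∈ uIcc a b, ‖f' t‖ ≤ C) : ‖f b - f a‖ ≤ C * |b - a| := by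
  have h := Convex.norm_image_sub_le_of_norm_hasDerivWithin_le (fun t _ => (hf t).hasDerivWithinAt) hC (convex_uIcc a b)
    left_mem_uIcc right_mem_uIcc
  simpa [Real.norm_eq_abs] using h

/-- Real-valued segment mean-value inequality: `|f b − f a| ≤ C·|b − a|` when `|f′| ≤ C` on `[a, b]`. [folklore] -/
private theorem abs_sub_le_mul_of_hasDerivAt {f f' : ℝ → ℝ} {C a b : ℝ} (hf : ∀ t, HasDerivAt f (f' t) t)
    (hC : ∀ t ∈ uIcc a b, |f' t| ≤ C) : |f b - f a| ≤ C * |b - a| := by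
  have h := norm_sub_le_mul_of_hasDerivAt hf (fun t ht => by rw [Real.norm_eq_abs]; exact hC t ht)
  rwa [Real.norm_eq_abs] at h

/-- Two-term estimate for linear functionals: `|L v − L₀ v₀| ≤ ‖L − L₀‖·‖v‖ + ‖L₀‖·‖v − v₀‖`. [folklore] -/
private theorem abs_clm_apply_sub_le (L L₀ : F →L[ℝ] ℝ) (v v₀ : F) :
    |L v - L₀ v₀| ≤ ‖L - L₀‖ * ‖v‖ + ‖L₀‖ * ‖v - v₀‖ := by
  have h1 : L v - L₀ v₀ = (L - L₀) v + L₀ (v - v₀) := by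
    rw [map_sub, show (L - L₀) v = L v - L₀ v from rfl]; ring
  have h2 : |(L - L₀) v| ≤ ‖L - L₀‖ * ‖v‖ := by
    rw [← Real.norm_eq_abs]; exact (L - L₀).le_opNorm v
  have h3 : |L₀ (v - v₀)| ≤ ‖L₀‖ * ‖v - v₀‖ := by
    rw [← Real.norm_eq_abs]; exact L₀.le_opNorm _
  rw [h1]
  exact (abs_add_le _ _).trans (add_le_add h2 h3)

variable {E : F → ℝ} {E' : F → F →L[ℝ] ℝ} (hE : ∀ x, HasFDerivAt E (E' x) x)
  {G H : ℝ} (hG : ∀ x, ‖E' x‖ ≤ G) (hH : ∀ x y, ‖E' x - E' y‖ ≤ H * ‖x - y‖) (hH0 : 0 ≤ H)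
  {γ γ' : ℝ → F} (hγ : ∀ θ, HasDerivAt γ (γ' θ) θ) {V A : ℝ} (hV : ∀ θ, ‖γ' θ‖ ≤ V)
  (hA : ∀ s t, ‖γ' s - γ' t‖ ≤ A * |s - t|)
  (hsym : ∀ θ, γ (θ + π) = -γ θ) {μ : ℝ} (hlev : ∀ θ, E (γ θ) = μ)

include hG hH hH0 in
/-- **Pairing estimate**: `|E′(S)v − E′(S₀)v₀| ≤ H·D₁·V + G·D₂` whenever `‖S − S₀‖ ≤ D₁`, `‖v‖ ≤ V`, `‖v − v₀‖ ≤ D₂`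
(the estimate behind every gradient bound of the anisotropic sector lemma). [cite: BenfattoGiulianiMastropietro2006, App. A3 Lemma A3.1] -/
theorem abs_pairing_sub_le {S S₀ v v₀ : F} {D₁ D₂ W : ℝ} (hS : ‖S - S₀‖ ≤ D₁) (hv : ‖v‖ ≤ W) (hvv : ‖v - v₀‖ ≤ D₂) :
    |E' S v - E' S₀ v₀| ≤ H * D₁ * W + G * D₂ := by
  have hG0 : 0 ≤ G := (norm_nonneg _).trans (hG S₀)
  have h1 : ‖E' S - E' S₀‖ * ‖v‖ ≤ H * D₁ * W := by
    have ha : ‖E' S - E' S₀‖ ≤ H * D₁ := (hH S S₀).trans (mul_le_mul_of_nonneg_left hS hH0)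
    have hb : 0 ≤ H * D₁ := (norm_nonneg _).trans ha
    exact mul_le_mul ha hv (norm_nonneg _) hb
  have h2 : ‖E' S₀‖ * ‖v - v₀‖ ≤ G * D₂ := mul_le_mul (hG S₀) hvv (norm_nonneg _) hG0
  exact (abs_clm_apply_sub_le _ _ _ _).trans (add_le_add h1 h2)

include hγ hV in
/-- The curve is `V`-Lipschitz: `‖γ s − γ t‖ ≤ V·|s − t|`. [cite: BenfattoGiulianiMastropietro2006, App. A3 Lemma A3.1] -/
theorem curve_norm_sub_le (s t : ℝ) : ‖γ s - γ t‖ ≤ V * |s - t| :=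
  norm_sub_le_mul_of_hasDerivAt hγ fun u _ => hV u

include hγ hsym in
/-- Central symmetry differentiates: `γ′(θ + π) = −γ′(θ)` (the symmetric Fermi surface of the cited counting lemma).
[cite: BenfattoGiulianiMastropietro2006, App. A3 Lemma A3.1] -/
theorem curve_deriv_add_pi (θ : ℝ) : γ' (θ + π) = -γ' θ := by
  have h1 : HasDerivAt (fun s => γ (s + π)) (γ' (θ + π)) θ := (hγ (θ + π)).comp_add_const θ π
  have h2 : HasDerivAt (fun s => γ (s + π)) (-γ' θ) θ := by
    have : (fun s => γ (s + π)) = fun s => -γ s := funext hsym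
    rw [this]; exact (hγ θ).neg
  exact h1.unique h2

include hsym in
omit [NormedSpace ℝ F] in
/-- Central symmetry at the level of points: `γ x + γ (x + π) = 0`. [cite: BenfattoGiulianiMastropietro2006, App. A3 Lemma A3.1] -/
theorem curve_add_curve_add_pi (x : ℝ) : γ x + γ (x + π) = 0 := by
  rw [hsym, add_neg_cancel]

include hE hγ hlev in
/-- On the level curve the tangent is in the kernel of the differential: `E′(γθ)[γ′θ] = 0`. [cite: BenfattoGiulianiMastropietro2006, App. A3 Lemma A3.1] -/
theorem fderiv_apply_tangent_eq_zero (θ : ℝ) : E' (γ θ) (γ' θ) = 0 := by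
  have h1 : HasDerivAt (E ∘ γ) (E' (γ θ) (γ' θ)) θ := (hE (γ θ)).comp_hasDerivAt θ (hγ θ)
  have h2 : HasDerivAt (E ∘ γ) 0 θ := by
    have : E ∘ γ = fun _ => μ := funext hlev
    rw [this]; exact hasDerivAt_const θ μ
  exact h1.unique h2

include hE hγ in
/-- `∂₃` of the three-leg level function `h(θ₁, θ₂, θ₃) = E(γθ₁ + γθ₂ + γθ₃) − μ`. [cite: BenfattoGiulianiMastropietro2006, App. A3 Lemma A3.1] -/
theorem hasDerivAt_level3_three (θ₁ θ₂ θ₃ : ℝ) :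
    HasDerivAt (fun t => E (γ θ₁ + γ θ₂ + γ t) - μ) (E' (γ θ₁ + γ θ₂ + γ θ₃) (γ' θ₃)) θ₃ := by
  have h : HasDerivAt (fun t => γ θ₁ + γ θ₂ + γ t) (γ' θ₃) θ₃ := (hγ θ₃).const_add _
  exact ((hE _).comp_hasDerivAt θ₃ h).sub_const μ

include hE hγ in
/-- `∂₂` of the three-leg level function. [cite: BenfattoGiulianiMastropietro2006, App. A3 Lemma A3.1] -/
theorem hasDerivAt_level3_two (θ₁ θ₂ θ₃ : ℝ) :
    HasDerivAt (fun t => E (γ θ₁ + γ t + γ θ₃) - μ) (E' (γ θ₁ + γ θ₂ + γ θ₃) (γ' θ₂)) θ₂ := by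
  have h : HasDerivAt (fun t => γ θ₁ + γ t + γ θ₃) (γ' θ₂) θ₂ := ((hγ θ₂).const_add _).add_const _
  exact ((hE _).comp_hasDerivAt θ₂ h).sub_const μ

include hE hγ in
/-- `∂₁` of the three-leg level function. [cite: BenfattoGiulianiMastropietro2006, App. A3 Lemma A3.1] -/
theorem hasDerivAt_level3_one (θ₁ θ₂ θ₃ : ℝ) :
    HasDerivAt (fun t => E (γ t + γ θ₂ + γ θ₃) - μ) (E' (γ θ₁ + γ θ₂ + γ θ₃) (γ' θ₁)) θ₁ := by
  have h : HasDerivAt (fun t => γ t + γ θ₂ + γ θ₃) (γ' θ₁) θ₁ := ((hγ θ₁).add_const _).add_const _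
  exact ((hE _).comp_hasDerivAt θ₁ h).sub_const μ

include hsym hlev in
omit [NormedSpace ℝ F] in
/-- **The Cooper line is a zero line**: `h(θ₁, x, x + π) = E(γθ₁) − μ = 0` (BGM's `R₂` region: `k₂ + k₃ = 0` puts `k₄ = −k₁` on the
curve). [cite: BenfattoGiulianiMastropietro2006, App. A2] -/
theorem level3_antipodal (θ₁ x : ℝ) : E (γ θ₁ + γ x + γ (x + π)) - μ = 0 := by
  rw [add_assoc, curve_add_curve_add_pi hsym, add_zero, hlev, sub_self]

/-! ## §2 The Cooper coefficient at a near-solution is `O(ρ/d + d)` -/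

include hE hG hH hH0 hγ hV hA hsym hlev in
/-- **The Cooper coefficient**: if `|h(θ₁′, x′, y′)| ≤ ρ` and `d := |y′ − x′ − π| > 0`, then `g := E′(γθ₁′)[γ′(x′ + π)]` — the coefficient of
`(c − π)` in `h(θ₁′, x′, x′ + c) = (c − π)·g + O((c − π)²)` — satisfies `|g| ≤ ρ/d + (H·V² + G·A)·d`.
[cite: BenfattoGiulianiMastropietro2006, App. A3 Lemma A3.1] -/
theorem abs_cooperCoeff_le {θ₁' x' y' ρ : ℝ} (hρ : |E (γ θ₁' + γ x' + γ y') - μ| ≤ ρ) (hd : 0 < |y' - x' - π|) :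
    |E' (γ θ₁') (γ' (x' + π))| ≤ ρ / |y' - x' - π| + (H * V ^ 2 + G * A) * |y' - x' - π| := by
  have hV0 : 0 ≤ V := (norm_nonneg _).trans (hV 0)
  set g := E' (γ θ₁') (γ' (x' + π)) with hg
  set d := |y' - x' - π| with hdd
  -- `f(t) = h(θ₁′, x′, t) − (t − x′ − π)·g`, `f(x′ + π) = 0`, `|f′| ≤ (HV² + GA)·d` on the segment
  set f : ℝ → ℝ := fun t => E (γ θ₁' + γ x' + γ t) - μ - (t - x' - π) * g with hf
  have hf' : ∀ t, HasDerivAt f (E' (γ θ₁' + γ x' + γ t) (γ' t) - g) t := by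
    intro t
    have h1 := hasDerivAt_level3_three hE hγ (μ := μ) θ₁' x' t
    have h2 : HasDerivAt (fun t => (t - x' - π) * g) g t := by
      have := (((hasDerivAt_id t).sub_const x').sub_const π).mul_const g
      simpa using this
    exact h1.sub h2
  have hbound : ∀ t ∈ uIcc (x' + π) y', |E' (γ θ₁' + γ x' + γ t) (γ' t) - g| ≤ (H * V ^ 2 + G * A) * d := by
    intro t ht
    have ht' : |t - (x' + π)| ≤ d := by
      have := abs_sub_left_of_mem_uIcc ht
      rwa [show y' - (x' + π) = y' - x' - π by ring] at this
    have hS : ‖γ θ₁' + γ x' + γ t - γ θ₁'‖ ≤ V * d := by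
      have e : γ θ₁' + γ x' + γ t - γ θ₁' = γ t - γ (x' + π) := by
        have := curve_add_curve_add_pi hsym x'
        rw [show γ x' = -γ (x' + π) from eq_neg_of_add_eq_zero_left this]; abel
      rw [e]
      exact (curve_norm_sub_le hγ hV _ _).trans (mul_le_mul_of_nonneg_left ht' hV0)
    have hvv : ‖γ' t - γ' (x' + π)‖ ≤ A * d := by
      have hA0 : 0 ≤ A := by
        have h := hA 1 0; rw [sub_zero, abs_one, mul_one] at h; exact (norm_nonneg _).trans h
      exact (hA _ _).trans (mul_le_mul_of_nonneg_left ht' hA0)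
    have := abs_pairing_sub_le hG hH hH0 (S₀ := γ θ₁') (v₀ := γ' (x' + π)) hS (hV t) hvv
    rw [hg]
    calc |E' (γ θ₁' + γ x' + γ t) (γ' t) - E' (γ θ₁') (γ' (x' + π))| ≤ H * (V * d) * V + G * (A * d) := this
      _ = (H * V ^ 2 + G * A) * d := by ring
  have hmvt := abs_sub_le_mul_of_hasDerivAt hf' hbound
  -- `f(x′ + π) = 0`, `f(y′) = h − (y′ − x′ − π)·g`
  have hf0 : f (x' + π) = 0 := by
    rw [hf]; dsimp only
    rw [level3_antipodal hsym hlev, show x' + π - x' - π = 0 by ring, zero_mul, sub_zero]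
  have hfy : f y' = E (γ θ₁' + γ x' + γ y') - μ - (y' - x' - π) * g := rfl
  rw [hf0, sub_zero, hfy, show y' - (x' + π) = y' - x' - π by ring, ← hdd] at hmvt
  -- `d·|g| ≤ ρ + (HV² + GA)·d·d`
  have hkey : d * |g| ≤ ρ + (H * V ^ 2 + G * A) * d * d := by
    have e1 : |(y' - x' - π) * g| = d * |g| := by rw [abs_mul, ← hdd]
    have e2 : |(y' - x' - π) * g| ≤ |E (γ θ₁' + γ x' + γ y') - μ| +
        |E (γ θ₁' + γ x' + γ y') - μ - (y' - x' - π) * g| := by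
      have := abs_sub (E (γ θ₁' + γ x' + γ y') - μ) (E (γ θ₁' + γ x' + γ y') - μ - (y' - x' - π) * g)
      rwa [show E (γ θ₁' + γ x' + γ y') - μ - (E (γ θ₁' + γ x' + γ y') - μ - (y' - x' - π) * g) =
        (y' - x' - π) * g by ring] at this
    rw [← e1]; linarith
  have : |g| ≤ (ρ + (H * V ^ 2 + G * A) * d * d) / d := by
    rw [le_div_iff₀ hd]; linarith
  calc |g| ≤ (ρ + (H * V ^ 2 + G * A) * d * d) / d := this
    _ = ρ / d + (H * V ^ 2 + G * A) * d := by field_simp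

/-! ## §3 From a near-solution to the cell centres: the shift-affine Cooper tolerance -/

include hE hG hH hH0 hγ hV hA hsym hlev in
/-- **Thin Cooper tolerance (abstract form).**  Let `(θ₁′, x′, y′)` be a near-solution, `|h(θ₁′, x′, y′)| ≤ ρ`, with `d := |y′ − x′ − π| > 0`, and
let the centres satisfy `|θ₁ − θ₁′|, |x − x′|, |x + c − y′| ≤ ω`.  Then
`|h(θ₁, x, x + c)| ≤ ρ + ω·(2ρ/d + (5HV² + 3GA)·d + (8HV² + 2GA)·ω)`:
the three angular partials of `h` on the box are `≤ ρ/d + O(d + ω)` (legs `2, 3`) and `O(d + ω)` (leg `1`, by `E′(γθ)[γ′θ] = 0`).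
[cite: Mastropietro2008, ch. 14 (14.67)] -/
theorem abs_level3_le_of_near_zero {θ₁ x c θ₁' x' y' ρ ω : ℝ} (hρ : |E (γ θ₁' + γ x' + γ y') - μ| ≤ ρ)
    (hd : 0 < |y' - x' - π|) (h1 : |θ₁ - θ₁'| ≤ ω) (h2 : |x - x'| ≤ ω) (h3 : |x + c - y'| ≤ ω) :
    |E (γ θ₁ + γ x + γ (x + c)) - μ| ≤ ρ + ω * (2 * (ρ / |y' - x' - π|) +
      (5 * (H * V ^ 2) + 3 * (G * A)) * |y' - x' - π| + (8 * (H * V ^ 2) + 2 * (G * A)) * ω) := by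
  have hV0 : 0 ≤ V := (norm_nonneg _).trans (hV 0)
  have hG0 : 0 ≤ G := (norm_nonneg _).trans (hG 0)
  have hA0 : 0 ≤ A := by
    have h := hA 1 0; rw [sub_zero, abs_one, mul_one] at h; exact (norm_nonneg _).trans h
  have hω0 : 0 ≤ ω := (abs_nonneg _).trans h1
  have hHV : 0 ≤ H * V ^ 2 := by positivity
  have hGA : 0 ≤ G * A := mul_nonneg hG0 hA0
  set d := |y' - x' - π| with hdd
  have hd0 : 0 ≤ d := hd.le
  have hg := abs_cooperCoeff_le hE hG hH hH0 hγ hV hA hsym hlev hρ hd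
  rw [← hdd] at hg
  set ga := |E' (γ θ₁') (γ' (x' + π))| with hga
  have hgx : |E' (γ θ₁') (γ' x')| = ga := by
    rw [hga, curve_deriv_add_pi hγ hsym, map_neg, abs_neg]
  have hxπ : γ x' = -γ (x' + π) := eq_neg_of_add_eq_zero_left (curve_add_curve_add_pi hsym x')
  -- box estimates: for `|θ − θ₁′| ≤ ω`, `|ξ₂ − x′| ≤ ω`, `|ξ₃ − y′| ≤ ω`
  have hsum : ∀ ξ₂ ξ₃ : ℝ, |ξ₂ - x'| ≤ ω → |ξ₃ - y'| ≤ ω → ‖γ ξ₂ + γ ξ₃‖ ≤ V * (2 * ω + d) := by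
    intro ξ₂ ξ₃ hξ₂ hξ₃
    have e : γ ξ₂ + γ ξ₃ = (γ ξ₂ - γ x') + (γ ξ₃ - γ (x' + π)) := by rw [hxπ]; abel
    have hξ₃' : |ξ₃ - (x' + π)| ≤ ω + d := by
      have : ξ₃ - (x' + π) = (ξ₃ - y') + (y' - x' - π) := by ring
      rw [this]; exact (abs_add_le _ _).trans (add_le_add hξ₃ le_rfl)
    rw [e]
    calc ‖(γ ξ₂ - γ x') + (γ ξ₃ - γ (x' + π))‖ ≤ ‖γ ξ₂ - γ x'‖ + ‖γ ξ₃ - γ (x' + π)‖ := norm_add_le _ _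
      _ ≤ V * |ξ₂ - x'| + V * |ξ₃ - (x' + π)| :=
          add_le_add (curve_norm_sub_le hγ hV _ _) (curve_norm_sub_le hγ hV _ _)
      _ ≤ V * ω + V * (ω + d) := add_le_add (mul_le_mul_of_nonneg_left hξ₂ hV0) (mul_le_mul_of_nonneg_left hξ₃' hV0)
      _ = V * (2 * ω + d) := by ring
  have hB1 : ∀ θ ξ₂ ξ₃ : ℝ, |ξ₂ - x'| ≤ ω → |ξ₃ - y'| ≤ ω →
      |E' (γ θ + γ ξ₂ + γ ξ₃) (γ' θ)| ≤ H * V ^ 2 * (2 * ω + d) := by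
    intro θ ξ₂ ξ₃ hξ₂ hξ₃
    have hS : ‖γ θ + γ ξ₂ + γ ξ₃ - γ θ‖ ≤ V * (2 * ω + d) := by
      rw [show γ θ + γ ξ₂ + γ ξ₃ - γ θ = γ ξ₂ + γ ξ₃ by abel]; exact hsum ξ₂ ξ₃ hξ₂ hξ₃
    have hvv : ‖γ' θ - γ' θ‖ ≤ 0 := by rw [sub_self, norm_zero]
    have := abs_pairing_sub_le hG hH hH0 (S₀ := γ θ) (v₀ := γ' θ) hS (hV θ) hvv
    rw [fderiv_apply_tangent_eq_zero hE hγ hlev, sub_zero] at this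
    calc |E' (γ θ + γ ξ₂ + γ ξ₃) (γ' θ)| ≤ H * (V * (2 * ω + d)) * V + G * 0 := this
      _ = H * V ^ 2 * (2 * ω + d) := by ring
  have hB23 : ∀ θ ξ₂ ξ₃ v₀ : ℝ, ∀ D₂ : ℝ, |θ - θ₁'| ≤ ω → |ξ₂ - x'| ≤ ω → |ξ₃ - y'| ≤ ω →
      ∀ ξ : ℝ, ‖γ' ξ - γ' v₀‖ ≤ D₂ → |E' (γ θ₁') (γ' v₀)| = ga →
      |E' (γ θ + γ ξ₂ + γ ξ₃) (γ' ξ)| ≤ ga + H * V ^ 2 * (3 * ω + d) + G * D₂ := by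
    intro θ ξ₂ ξ₃ v₀ D₂ hθ hξ₂ hξ₃ ξ hD hv₀
    have hS : ‖γ θ + γ ξ₂ + γ ξ₃ - γ θ₁'‖ ≤ V * (3 * ω + d) := by
      rw [show γ θ + γ ξ₂ + γ ξ₃ - γ θ₁' = (γ θ - γ θ₁') + (γ ξ₂ + γ ξ₃) by abel]
      calc ‖(γ θ - γ θ₁') + (γ ξ₂ + γ ξ₃)‖ ≤ ‖γ θ - γ θ₁'‖ + ‖γ ξ₂ + γ ξ₃‖ := norm_add_le _ _
        _ ≤ V * |θ - θ₁'| + V * (2 * ω + d) := add_le_add (curve_norm_sub_le hγ hV _ _) (hsum ξ₂ ξ₃ hξ₂ hξ₃)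
        _ ≤ V * ω + V * (2 * ω + d) := by nlinarith [mul_le_mul_of_nonneg_left hθ hV0]
        _ = V * (3 * ω + d) := by ring
    have := abs_pairing_sub_le hG hH hH0 (S₀ := γ θ₁') (v₀ := γ' v₀) hS (hV ξ) hD
    have htri : |E' (γ θ + γ ξ₂ + γ ξ₃) (γ' ξ)| ≤ |E' (γ θ₁') (γ' v₀)| +
        |E' (γ θ + γ ξ₂ + γ ξ₃) (γ' ξ) - E' (γ θ₁') (γ' v₀)| := by
      have := abs_add_le (E' (γ θ₁') (γ' v₀)) (E' (γ θ + γ ξ₂ + γ ξ₃) (γ' ξ) - E' (γ θ₁') (γ' v₀))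
      rwa [add_sub_cancel] at this
    rw [hv₀] at htri
    calc |E' (γ θ + γ ξ₂ + γ ξ₃) (γ' ξ)| ≤ ga + (H * (V * (3 * ω + d)) * V + G * D₂) := htri.trans (by linarith)
      _ = ga + H * V ^ 2 * (3 * ω + d) + G * D₂ := by ring
  -- move 1: `θ₁′ → θ₁` at `(·, x′, y′)`
  have hM1 : |(E (γ θ₁ + γ x' + γ y') - μ) - (E (γ θ₁' + γ x' + γ y') - μ)| ≤ H * V ^ 2 * (2 * ω + d) * ω := by
    have hb : ∀ t ∈ uIcc θ₁' θ₁, |E' (γ t + γ x' + γ y') (γ' t)| ≤ H * V ^ 2 * (2 * ω + d) := fun t _ =>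
      hB1 t x' y' (by rw [sub_self, abs_zero]; exact hω0) (by rw [sub_self, abs_zero]; exact hω0)
    have := abs_sub_le_mul_of_hasDerivAt (fun t => hasDerivAt_level3_one hE hγ (μ := μ) t x' y') hb
    exact this.trans (mul_le_mul_of_nonneg_left h1 (by positivity))
  -- move 2: `x′ → x` at `(θ₁, ·, y′)`
  have hM2 : |(E (γ θ₁ + γ x + γ y') - μ) - (E (γ θ₁ + γ x' + γ y') - μ)| ≤
      (ga + H * V ^ 2 * (3 * ω + d) + G * (A * ω)) * ω := by
    have hb : ∀ t ∈ uIcc x' x, |E' (γ θ₁ + γ t + γ y') (γ' t)| ≤ ga + H * V ^ 2 * (3 * ω + d) + G * (A * ω) := by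
      intro t ht
      have ht' : |t - x'| ≤ ω := (abs_sub_left_of_mem_uIcc ht).trans h2
      exact hB23 θ₁ t y' x' (A * ω) h1 ht' (by rw [sub_self, abs_zero]; exact hω0) t
        ((hA _ _).trans (mul_le_mul_of_nonneg_left ht' hA0)) hgx
    have := abs_sub_le_mul_of_hasDerivAt (fun t => hasDerivAt_level3_two hE hγ (μ := μ) θ₁ t y') hb
    have hnn : 0 ≤ ga + H * V ^ 2 * (3 * ω + d) + G * (A * ω) := by positivity
    exact this.trans (mul_le_mul_of_nonneg_left h2 hnn)
  -- move 3: `y′ → x + c` at `(θ₁, x, ·)`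
  have hM3 : |(E (γ θ₁ + γ x + γ (x + c)) - μ) - (E (γ θ₁ + γ x + γ y') - μ)| ≤
      (ga + H * V ^ 2 * (3 * ω + d) + G * (A * (ω + d))) * ω := by
    have hb : ∀ t ∈ uIcc y' (x + c), |E' (γ θ₁ + γ x + γ t) (γ' t)| ≤
        ga + H * V ^ 2 * (3 * ω + d) + G * (A * (ω + d)) := by
      intro t ht
      have ht' : |t - y'| ≤ ω := (abs_sub_left_of_mem_uIcc ht).trans h3
      have ht'' : |t - (x' + π)| ≤ ω + d := by
        have : t - (x' + π) = (t - y') + (y' - x' - π) := by ring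
        rw [this]; exact (abs_add_le _ _).trans (add_le_add ht' le_rfl)
      exact hB23 θ₁ x t (x' + π) (A * (ω + d)) h1 h2 ht' t
        ((hA _ _).trans (mul_le_mul_of_nonneg_left ht'' hA0)) rfl
    have := abs_sub_le_mul_of_hasDerivAt (fun t => hasDerivAt_level3_three hE hγ (μ := μ) θ₁ x t) hb
    have hnn : 0 ≤ ga + H * V ^ 2 * (3 * ω + d) + G * (A * (ω + d)) := by positivity
    exact this.trans (mul_le_mul_of_nonneg_left h3 hnn)
  have htri : |E (γ θ₁ + γ x + γ (x + c)) - μ| ≤ |E (γ θ₁' + γ x' + γ y') - μ| +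
      |(E (γ θ₁ + γ x' + γ y') - μ) - (E (γ θ₁' + γ x' + γ y') - μ)| +
      |(E (γ θ₁ + γ x + γ y') - μ) - (E (γ θ₁ + γ x' + γ y') - μ)| +
      |(E (γ θ₁ + γ x + γ (x + c)) - μ) - (E (γ θ₁ + γ x + γ y') - μ)| := by
    have a1 := abs_sub_abs_le_abs_sub (E (γ θ₁ + γ x' + γ y') - μ) (E (γ θ₁' + γ x' + γ y') - μ)
    have a2 := abs_sub_abs_le_abs_sub (E (γ θ₁ + γ x + γ y') - μ) (E (γ θ₁ + γ x' + γ y') - μ)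
    have a3 := abs_sub_abs_le_abs_sub (E (γ θ₁ + γ x + γ (x + c)) - μ) (E (γ θ₁ + γ x + γ y') - μ)
    linarith
  have hgaω : ga * ω ≤ (ρ / d + (H * V ^ 2 + G * A) * d) * ω := mul_le_mul_of_nonneg_right hg hω0
  nlinarith [htri, hM1, hM2, hM3, hgaω, hρ]

include hE hG hH hH0 hγ hV hA hsym hlev in
/-- **Thin Cooper tolerance (sector currency).**  With boxes of half-width `ω ≤ w`, near-solution defect `ρ ≤ C_r·w²` and a shift bounded away from
`π` at the near-solution, `d₀·w ≤ |y′ − x′ − π|`, the level at the centres obeys the SHIFT-AFFINE bound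
`|h(θ₁, x, x + c)| ≤ (C_r + 2C_r/d₀ + 2K₁ + K₂)·w² + K₁·w·|c − π|`, `K₁ = 5HV² + 3GA`, `K₂ = 8HV² + 2GA` — tolerance `δ₀ + δ₁|c − π|` with
`δ₀ ≍ w²`, `δ₁ ≍ w` (the input of `BandSectorCounting.count_odd_total_thin`), NOT the isotropic `δ ≍ w`.
[cite: Mastropietro2008, ch. 14 (14.67) p. 223; p. 229] -/
theorem abs_level3_le_thin {θ₁ x c θ₁' x' y' ρ ω w Cr d₀ : ℝ} (hρ : |E (γ θ₁' + γ x' + γ y') - μ| ≤ ρ)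
    (hw : 0 < w) (hωw : ω ≤ w) (hCr : ρ ≤ Cr * w ^ 2) (hd₀ : 0 < d₀) (hd₀w : d₀ * w ≤ |y' - x' - π|)
    (h1 : |θ₁ - θ₁'| ≤ ω) (h2 : |x - x'| ≤ ω) (h3 : |x + c - y'| ≤ ω) :
    |E (γ θ₁ + γ x + γ (x + c)) - μ| ≤
      (Cr + 2 * Cr / d₀ + 2 * (5 * (H * V ^ 2) + 3 * (G * A)) + (8 * (H * V ^ 2) + 2 * (G * A))) * w ^ 2 +
        (5 * (H * V ^ 2) + 3 * (G * A)) * w * |c - π| := by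
  have hV0 : 0 ≤ V := (norm_nonneg _).trans (hV 0)
  have hG0 : 0 ≤ G := (norm_nonneg _).trans (hG 0)
  have hA0 : 0 ≤ A := by
    have h := hA 1 0; rw [sub_zero, abs_one, mul_one] at h; exact (norm_nonneg _).trans h
  have hω0 : 0 ≤ ω := (abs_nonneg _).trans h1
  have hHV : 0 ≤ H * V ^ 2 := by positivity
  have hGA : 0 ≤ G * A := mul_nonneg hG0 hA0
  set K₁ := 5 * (H * V ^ 2) + 3 * (G * A) with hK₁
  set K₂ := 8 * (H * V ^ 2) + 2 * (G * A) with hK₂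
  have hK₁0 : 0 ≤ K₁ := by positivity
  have hK₂0 : 0 ≤ K₂ := by positivity
  set d := |y' - x' - π| with hdd
  have hd : 0 < d := lt_of_lt_of_le (by positivity) hd₀w
  have hmain := abs_level3_le_of_near_zero hE hG hH hH0 hγ hV hA hsym hlev (c := c) hρ hd h1 h2 h3
  rw [← hdd, ← hK₁, ← hK₂] at hmain
  have hρ0 : 0 ≤ ρ := (abs_nonneg _).trans hρ
  -- `ρ/d ≤ (C_r/d₀)·w`
  have hρd : ρ / d ≤ Cr / d₀ * w := by
    rw [div_le_iff₀ hd]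
    calc ρ ≤ Cr * w ^ 2 := hCr
      _ = Cr / d₀ * w * (d₀ * w) := by field_simp
      _ ≤ Cr / d₀ * w * d := by
          apply mul_le_mul_of_nonneg_left hd₀w
          have : 0 ≤ Cr * w ^ 2 := hρ0.trans hCr
          have hCr0 : 0 ≤ Cr := by
            by_contra hneg
            have : Cr * w ^ 2 < 0 := mul_neg_of_neg_of_pos (lt_of_not_ge hneg) (by positivity)
            linarith
          positivity
  -- `d ≤ |c − π| + 2ω`
  have hdc : d ≤ |c - π| + 2 * ω := by
    have e : y' - x' - π = (c - π) - (x + c - y') + (x - x') := by ring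
    rw [hdd, e]
    calc |(c - π) - (x + c - y') + (x - x')| ≤ |(c - π) - (x + c - y')| + |x - x'| := abs_add_le _ _
      _ ≤ |c - π| + |x + c - y'| + |x - x'| := by linarith [abs_sub (c - π) (x + c - y')]
      _ ≤ |c - π| + 2 * ω := by linarith
  have t1 : ω * (2 * (ρ / d)) ≤ 2 * (Cr / d₀) * w ^ 2 := by
    have hρd0 : 0 ≤ ρ / d := div_nonneg hρ0 hd.le
    have u1 : ω * (ρ / d) ≤ ω * (Cr / d₀ * w) := mul_le_mul_of_nonneg_left hρd hω0
    have u2 : ω * (Cr / d₀ * w) ≤ w * (Cr / d₀ * w) := mul_le_mul_of_nonneg_right hωw (hρd0.trans hρd)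
    nlinarith [u1, u2]
  have t2 : ω * (K₁ * d) ≤ K₁ * w * |c - π| + 2 * K₁ * w ^ 2 := by
    have : ω * (K₁ * d) ≤ w * (K₁ * (|c - π| + 2 * w)) := by
      apply mul_le_mul hωw _ (by positivity) hw.le
      exact mul_le_mul_of_nonneg_left (hdc.trans (by linarith)) hK₁0
    nlinarith
  have t3 : ω * (K₂ * ω) ≤ K₂ * w ^ 2 := by nlinarith [mul_le_mul hωw hωw hω0 hw.le]
  have : ρ + ω * (2 * (ρ / d) + K₁ * d + K₂ * ω) ≤
      (Cr + 2 * Cr / d₀ + 2 * K₁ + K₂) * w ^ 2 + K₁ * w * |c - π| := by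
    have e : ω * (2 * (ρ / d) + K₁ * d + K₂ * ω) = ω * (2 * (ρ / d)) + ω * (K₁ * d) + ω * (K₂ * ω) := by ring
    rw [e]
    have e2 : (Cr + 2 * Cr / d₀ + 2 * K₁ + K₂) * w ^ 2 = Cr * w ^ 2 + 2 * (Cr / d₀) * w ^ 2 + 2 * K₁ * w ^ 2 + K₂ * w ^ 2 := by ring
    rw [e2]; linarith
  exact hmain.trans this

end Calculus

end Literature.MathematicalPhysics.QuantumLattice.ThinSectorCount

end
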